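import Summits.BirchSwinnertonDyer.BirchSwinnertonDyer.Theorems.EisensteinDepletionAtTwoStarOddManinDoor
import Summits.BirchSwinnertonDyer.BirchSwinnertonDyer.Theorems.EisensteinDepletionAtTwoStarOptBNSFParityGroup
import Literature.NumberTheory.EllipticCurves.ModularSymbolsProofs
import Literature.NumberTheory.EllipticCurves.OrdinaryPrimesProofs
import Literature.NumberTheory.EllipticCurves.ModularityVersionApProofs
import Literature.NumberTheory.EllipticCurves.Gamma1ParametrizationCuspIdentityComponent
import Literature.NumberTheory.EllipticCurves.ManinConstantGamma1ModularDegree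
import Mathlib.RingTheory.Polynomial.RationalRoot
import HarnessLib

/-!
# Stub S5 `stub_doubleLiftFalse` of line `star` v18 (crux E1M, stmt-BirchSwinnertonDyer-20341): two ÉTALE rational 2-torsion points of the
# optimal curve cannot both lift through `Γ₁(N)` when the Manin constant is even (lead star-p1 GEN 21, 2026-08-29)

The (F)-side end of the parity split.  For the `X₀(N)`-lattice-optimal minimal `W₀` (`Λ₀ = q·Λ_f`, `N = N_{W₀} ≥ 11` odd) with a
hypothetically EVEN `q` and two distinct étale rational 2-torsion abscissae `x₀ ≠ x₁` (half-periods `λ₀, λ₁`) that both satisfy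
LIFT — `q{∞,γ∞}_f ∈ ℤλᵢ + 2Λ₀` for every `γ ∈ Γ₁(N)` —:
* `(ℤλ₀ + 2Λ₀) ∩ (ℤλ₁ + 2Λ₀) = 2Λ₀` (`℘` separates the two half-periods), so `(q/2)·Λ₁(f) ⊆ Λ₀` with `q/2 ∈ ℤ`;
* every `λ ∈ Λ₀` is `q·{∞,γ∞}_f` for a single `γ ∈ Γ₀(N)` (`Λ₀ ⊆ qΛ_f` and `γ ↦ {∞,γ∞}_f` is a homomorphism), so both 2-torsion points
  `Pᵢ` are cusp images of the `X₁(N)`-parametrisation `τ ↦ (q/2)∫f` and (F) makes them non-singular modulo every prime;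
* but at an odd prime `p ∣ N` (bad for `W₀`, `p ∣ Δ_min = 16((x₀−x₁)(x₀−e₂)(x₁−e₂))²`) one of `Φ_x(P₀) = −(x₀−x₁)(x₀−e₂)`,
  `Φ_x(P₁) = −(x₁−x₀)(x₁−e₂)` has positive valuation while `Φ_y(Pᵢ) = 0` and `xᵢ` is `p`-integral — contradiction.
No number theory beyond (F); nothing here reads `r_an`; E1M / BSD are NOT proved by this file.
-/

set_option linter.dupNamespace false
set_option autoImplicit false

noncomputable section

open scoped MatrixGroups ModularForm
open CongruenceSubgroup
open Literature.NumberTheory.EllipticCurves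
open Literature.NumberTheory.EllipticCurves.Greenberg1999
open Literature.NumberTheory.EllipticCurves.ModularForms

namespace Summit.BirchSwinnertonDyer.BirchSwinnertonDyer.Theorems.DepletionAtTwo.EvenBranch

/-! ### §1 Lattice lemmas -/

/-- Integer multiples stay in the lattice. [folklore] -/
theorem intCast_mul_mem_lattice (L : PeriodPair) {lam : ℂ} (hlam : lam ∈ L.lattice) (m : ℤ) :
    (m : ℂ) * lam ∈ L.lattice := by
  rw [← zsmul_eq_mul]
  exact L.lattice.smul_mem m hlam

/-- Every element of the period lattice `Λ_f` is a single period `{∞,γ∞}_f`, `γ ∈ Γ₀(N)` (the cusp symbol is a homomorphism: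
Manin). [cite: Manin1972, Prop. 1.4 / Thm. 1.6] -/
theorem exists_cuspSymbol_eq_of_mem_periodLattice {N : ℕ} [NeZero N] (f : CuspForm (Gamma0 N) 2) {w : ℂ}
    (hw : w ∈ periodLattice f) : ∃ γ : Gamma0 N, cuspSymbol f γ = w := by
  induction hw using AddSubgroup.closure_induction with
  | mem x hx =>
    obtain ⟨γ, rfl⟩ := hx
    exact ⟨γ, rfl⟩
  | zero => exact ⟨1, cuspSymbol_one f⟩
  | add x y _ _ hx hy =>
    obtain ⟨γ, rfl⟩ := hx
    obtain ⟨δ, rfl⟩ := hy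
    exact ⟨γ * δ, cuspSymbol_mul_holds f γ δ⟩
  | neg x _ hx =>
    obtain ⟨γ, rfl⟩ := hx
    refine ⟨γ⁻¹, ?_⟩
    have h := cuspSymbol_mul_holds f γ γ⁻¹
    rw [mul_inv_cancel, cuspSymbol_one] at h
    linear_combination -h

/-- **Two half-lattices meet in `2Λ`**: if `λ₀, λ₁ ∈ Λ` have distinct `℘`-values at their halves (two distinct 2-torsion points), then
`(ℤλ₀ + 2Λ) ∩ (ℤλ₁ + 2Λ) ⊆ 2Λ`. [cite: SilvermanAEC2009, VI.3.6] -/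
theorem exists_eq_two_mul_of_mem_half_lattices (L : PeriodPair) {lam₀ lam₁ z : ℂ}
    (hlam₀ : lam₀ ∈ L.lattice) (hlam₁ : lam₁ ∈ L.lattice)
    (hne : L.weierstrassP (lam₀ / 2) ≠ L.weierstrassP (lam₁ / 2))
    (h₀ : ∃ k : ℤ, ∃ w ∈ L.lattice, z = (k : ℂ) * lam₀ + 2 * w)
    (h₁ : ∃ k : ℤ, ∃ w ∈ L.lattice, z = (k : ℂ) * lam₁ + 2 * w) :
    ∃ w ∈ L.lattice, z = 2 * w := by
  obtain ⟨k₀, w₀, hw₀, hz₀⟩ := h₀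
  obtain ⟨k₁, w₁, hw₁, hz₁⟩ := h₁
  rcases Int.even_or_odd k₀ with ⟨m₀, hm₀⟩ | ⟨m₀, hm₀⟩
  · refine ⟨(m₀ : ℂ) * lam₀ + w₀, add_mem (intCast_mul_mem_lattice L hlam₀ m₀) hw₀, ?_⟩
    rw [hz₀, hm₀]; push_cast; ring
  rcases Int.even_or_odd k₁ with ⟨m₁, hm₁⟩ | ⟨m₁, hm₁⟩
  · refine ⟨(m₁ : ℂ) * lam₁ + w₁, add_mem (intCast_mul_mem_lattice L hlam₁ m₁) hw₁, ?_⟩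
    rw [hz₁, hm₁]; push_cast; ring
  -- both odd: `(λ₀ − λ₁)/2 ∈ Λ`, contradicting `℘(λ₀/2) ≠ ℘(λ₁/2)`
  exfalso
  have hdiff : lam₀ / 2 - lam₁ / 2 ∈ L.lattice := by
    have : lam₀ / 2 - lam₁ / 2 = (m₁ : ℂ) * lam₁ + w₁ - ((m₀ : ℂ) * lam₀ + w₀) := by
      have e : (k₀ : ℂ) * lam₀ + 2 * w₀ = (k₁ : ℂ) * lam₁ + 2 * w₁ := by rw [← hz₀, ← hz₁]
      rw [hm₀, hm₁] at e; push_cast at e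
      linear_combination e / 2
    rw [this]
    exact sub_mem (add_mem (intCast_mul_mem_lattice L hlam₁ m₁) hw₁)
      (add_mem (intCast_mul_mem_lattice L hlam₀ m₀) hw₀)
  apply hne
  have h := L.weierstrassP_add_coe (lam₁ / 2) ⟨_, hdiff⟩
  simp only at h
  rw [show lam₁ / 2 + (lam₀ / 2 - lam₁ / 2) = lam₀ / 2 by ring] at h
  exact h

/-! ### §2 Algebra of two rational 2-torsion abscissae -/

/-- A rational 2-torsion abscissa is a root of the 2-division cubic `4x³ + b₂x² + 2b₄x + b₆`. [cite: SilvermanAEC2009, III.1] -/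
theorem cubic_eq_zero_of_hasRationalTwoTorsionX (W : WeierstrassCurve ℚ) {x : ℚ} (hx : HasRationalTwoTorsionX W x) :
    4 * x ^ 3 + W.b₂ * x ^ 2 + 2 * W.b₄ * x + W.b₆ = 0 := by
  obtain ⟨y, heq, h2⟩ := hx
  rw [WeierstrassCurve.Affine.equation_iff] at heq
  have e : (2 * y + W.a₁ * x + W.a₃) ^ 2 = 4 * x ^ 3 + W.b₂ * x ^ 2 + 2 * W.b₄ * x + W.b₆ := by
    simp only [WeierstrassCurve.b₂, WeierstrassCurve.b₄, WeierstrassCurve.b₆]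
    linear_combination 4 * heq
  rw [← e, h2]
  ring

/-- Vieta for two distinct rational roots `x ≠ x'` of the 2-division cubic: with the third root `e = −b₂/4 − x − x'`,
`b₄ = 2(xx' + (x+x')e)` and `b₆ = −4xx'e`. [folklore] -/
theorem b₄_b₆_of_two_roots (W : WeierstrassCurve ℚ) {x x' : ℚ} (hne : x ≠ x')
    (h₀ : 4 * x ^ 3 + W.b₂ * x ^ 2 + 2 * W.b₄ * x + W.b₆ = 0)
    (h₁ : 4 * x' ^ 3 + W.b₂ * x' ^ 2 + 2 * W.b₄ * x' + W.b₆ = 0) :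
    W.b₄ = 2 * (x * x' + (x + x') * (-W.b₂ / 4 - x - x')) ∧
      W.b₆ = -4 * x * x' * (-W.b₂ / 4 - x - x') := by
  have hq : (x - x') * (4 * (x ^ 2 + x * x' + x' ^ 2) + W.b₂ * (x + x') + 2 * W.b₄) = 0 := by
    linear_combination h₀ - h₁
  rcases mul_eq_zero.mp hq with h | h
  · exact absurd (sub_eq_zero.mp h) hne
  exact ⟨by linear_combination h / 2, by linear_combination h₀ - x * h⟩

/-- On the curve, the `y`-coordinate over a rational 2-torsion abscissa is unique: `2y + a₁x + a₃ = 0`. [folklore] -/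
theorem two_y_eq_of_equation_of_hasRationalTwoTorsionX (W : WeierstrassCurve ℚ) {x y : ℚ} (heq : W.toAffine.Equation x y)
    (hx : HasRationalTwoTorsionX W x) : 2 * y + W.a₁ * x + W.a₃ = 0 := by
  obtain ⟨y₀, heq₀, h2⟩ := hx
  rw [WeierstrassCurve.Affine.equation_iff] at heq heq₀
  have hsq : (y - y₀) ^ 2 = 0 := by linear_combination heq - heq₀ - (y - y₀) * h2
  have hy : y = y₀ := by
    have := pow_eq_zero_iff (n := 2) (two_ne_zero) |>.mp hsq
    linarith
  rw [hy, h2]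

/-- `Φ_x` at a rational 2-torsion point `(x, y)` in terms of the two other roots `x'`, `e = −b₂/4 − x − x'` of the 2-division cubic:
`Φ_x(x, y) = −(x − x')(x − e)`. [cite: SilvermanAEC2009, III.1] -/
theorem evalEval_polynomialX_of_two_roots (W : WeierstrassCurve ℚ) {x x' y : ℚ} (hne : x ≠ x')
    (h₀ : 4 * x ^ 3 + W.b₂ * x ^ 2 + 2 * W.b₄ * x + W.b₆ = 0)
    (h₁ : 4 * x' ^ 3 + W.b₂ * x' ^ 2 + 2 * W.b₄ * x' + W.b₆ = 0) (h2 : 2 * y + W.a₁ * x + W.a₃ = 0) :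
    W.toAffine.polynomialX.evalEval x y = -((x - x') * (x - (-W.b₂ / 4 - x - x'))) := by
  obtain ⟨hB4, -⟩ := b₄_b₆_of_two_roots W hne h₀ h₁
  rw [WeierstrassCurve.Affine.evalEval_polynomialX]
  have hy : W.a₁ * y = -(W.a₁ ^ 2 * x + W.a₁ * W.a₃) / 2 := by linear_combination (W.a₁ / 2) * h2
  rw [hy]
  simp only [WeierstrassCurve.b₂, WeierstrassCurve.b₄] at hB4 ⊢
  linear_combination (-1 / 2 : ℚ) * hB4

/-- The discriminant in terms of two distinct rational roots `x ≠ x'` and the third root `e` of the 2-division cubic: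
`Δ = 16((x − x')(x − e)(x' − e))²`. [cite: SilvermanAEC2009, III.1] -/
theorem Δ_eq_of_two_roots (W : WeierstrassCurve ℚ) {x x' : ℚ} (hne : x ≠ x')
    (h₀ : 4 * x ^ 3 + W.b₂ * x ^ 2 + 2 * W.b₄ * x + W.b₆ = 0)
    (h₁ : 4 * x' ^ 3 + W.b₂ * x' ^ 2 + 2 * W.b₄ * x' + W.b₆ = 0) :
    W.Δ = 16 * ((x - x') * (x - (-W.b₂ / 4 - x - x')) * (x' - (-W.b₂ / 4 - x - x'))) ^ 2 := by
  obtain ⟨hB4, hB6⟩ := b₄_b₆_of_two_roots W hne h₀ h₁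
  have h8 : W.b₈ = (W.b₂ * W.b₆ - W.b₄ ^ 2) / 4 := by linear_combination W.b_relation / 4
  rw [WeierstrassCurve.Δ, h8, hB4, hB6]
  ring

/-! ### §3 The stub -/

/-- `p`-adic valuation of `z/n` when `p ∤ n`. [folklore] -/
theorem padicValRat_intCast_div_natCast {p : ℕ} [hp : Fact p.Prime] (z : ℤ) {n : ℕ} (hn0 : n ≠ 0) (hpn : ¬ p ∣ n) :
    padicValRat p ((z : ℚ) / (n : ℚ)) = padicValInt p z := by
  by_cases hz : z = 0
  · subst hz; simp
  rw [padicValRat.div (by exact_mod_cast hz) (by exact_mod_cast hn0), padicValRat.of_int, padicValRat.of_nat,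
    padicValNat.eq_zero_of_not_dvd hpn]
  simp

/-- An odd prime does not divide `4` or `16`. [folklore] -/
theorem not_dvd_four_sixteen {p : ℕ} (hp : p.Prime) (hp2 : p ≠ 2) : ¬ p ∣ 4 ∧ ¬ p ∣ 16 := by
  have h : ∀ k : ℕ, ¬ p ∣ 2 ^ k := fun k hk ↦
    hp2 ((Nat.prime_dvd_prime_iff_eq hp Nat.prime_two).mp (hp.dvd_of_dvd_pow hk))
  exact ⟨by simpa using h 2, by simpa using h 4⟩

/-- If an odd prime does not divide `z` in valuation terms (`v_p(z/16) = 0`, `z ≠ 0`) then `p ∤ z`. [folklore] -/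
theorem not_dvd_of_padicValInt_eq_zero {p : ℕ} [hp : Fact p.Prime] {z : ℤ} (hz : z ≠ 0) (hv : padicValInt p z = 0) :
    ¬ (p : ℤ) ∣ z := by
  intro h
  have h' : (p : ℤ) ^ 1 ∣ z := by rwa [pow_one]
  rcases (padicValInt_dvd_iff 1 z).mp h' with h0 | h1
  · exact hz h0
  · omega

/-- **Stub S5 `stub_doubleLiftFalse` of line `star` v18 — PROVED.**  See the file docstring.  (F) is the only input; the statement is the
registered signature verbatim. [cite: ConradEdixhovenStein2003, §6.1.2 proof of Lemma 6.1.6 (p. 381)] [cite: SilvermanAEC2009, VII.2 and III.1] -/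
theorem stub_doubleLiftFalse :
    gamma1Parametrization_cuspImage_nonsingularReduction →
    ∀ (W₀ : WeierstrassCurve ℚ) [W₀.IsElliptic] [W₀.IsGloballyMinimal] ⦃N : ℕ⦄ [NeZero N]
      (f : CuspForm (CongruenceSubgroup.Gamma0 N) 2), IsNewformOf W₀ f → ¬ 2 ∣ N → W₀.conductorNorm ℤ = N → 11 ≤ N → IsOrdinaryAt W₀ 2 →
      ∀ (L₀ : PeriodPair), IsNeronLatticeOf (W₀.baseChange ℂ) L₀ → ∀ (q : ℤ), q ≠ 0 → Even q →
      (∀ z ∈ periodLattice f, (q : ℂ) * z ∈ L₀.lattice) → (∀ z ∈ L₀.lattice, ∃ w ∈ periodLattice f, z = (q : ℂ) * w) →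
      ∀ (x₀ x₁ : ℚ), x₀ ≠ x₁ →
      HasRationalTwoTorsionX W₀ x₀ → ¬ TwoTorsionRamifiedAtTwo x₀ →
      ∀ (lam₀ : ℂ), lam₀ ∈ L₀.lattice → lam₀ / 2 ∉ L₀.lattice →
        L₀.weierstrassP (lam₀ / 2) - ((W₀.b₂ : ℚ) : ℂ) / 12 = ((x₀ : ℚ) : ℂ) →
      HasRationalTwoTorsionX W₀ x₁ → ¬ TwoTorsionRamifiedAtTwo x₁ →
      ∀ (lam₁ : ℂ), lam₁ ∈ L₀.lattice → lam₁ / 2 ∉ L₀.lattice →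
        L₀.weierstrassP (lam₁ / 2) - ((W₀.b₂ : ℚ) : ℂ) / 12 = ((x₁ : ℚ) : ℂ) →
      (∀ (γ : SL(2, ℤ)) (hγ : γ ∈ CongruenceSubgroup.Gamma0 N), γ ∈ CongruenceSubgroup.Gamma1 N →
        ∃ k : ℤ, ∃ w ∈ L₀.lattice, ((q : ℚ) : ℂ) * cuspSymbol f ⟨γ, hγ⟩ = (k : ℂ) * lam₀ + 2 * w) →
      (∀ (γ : SL(2, ℤ)) (hγ : γ ∈ CongruenceSubgroup.Gamma0 N), γ ∈ CongruenceSubgroup.Gamma1 N →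
        ∃ k : ℤ, ∃ w ∈ L₀.lattice, ((q : ℚ) : ℂ) * cuspSymbol f ⟨γ, hγ⟩ = (k : ℂ) * lam₁ + 2 * w) →
      False := by
  intro hF W₀ _ _ N _ f hW₀ h2N hN₀ h11 _ L₀ hL₀ q hq0 hev hin hout x₀ x₁ hne hx₀ _ lam₀ hlam₀ hlam₀2 h℘₀ hx₁ _
    lam₁ hlam₁ hlam₁2 h℘₁ hLift₀ hLift₁
  -- `q = 2c`
  obtain ⟨c, hc⟩ := hev
  have hqc : (q : ℂ) = 2 * (c : ℂ) := by rw [hc]; push_cast; ring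
  have hc0 : c ≠ 0 := by rintro rfl; simp at hc; exact hq0 hc
  -- `℘` separates the two half-periods
  have h℘ne : L₀.weierstrassP (lam₀ / 2) ≠ L₀.weierstrassP (lam₁ / 2) := by
    intro h
    apply hne
    have : ((x₀ : ℚ) : ℂ) = ((x₁ : ℚ) : ℂ) := by rw [← h℘₀, ← h℘₁, h]
    exact_mod_cast this
  -- `c·Λ₁(f) ⊆ Λ₀`
  have hcΓ₁ : ∀ z ∈ periodLatticeGamma1 f, (c : ℂ) * z ∈ L₀.lattice := by
    intro z hz
    induction hz using AddSubgroup.closure_induction with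
    | mem w hw =>
      obtain ⟨γ, rfl⟩ := hw
      have h0 := hLift₀ (γ : SL(2, ℤ)) (Gamma1_in_Gamma0 N γ.2) γ.2
      have h1 := hLift₁ (γ : SL(2, ℤ)) (Gamma1_in_Gamma0 N γ.2) γ.2
      simp only [Rat.cast_intCast] at h0 h1
      obtain ⟨w, hw, hw2⟩ := exists_eq_two_mul_of_mem_half_lattices L₀ hlam₀ hlam₁ h℘ne h0 h1
      have : (c : ℂ) * cuspSymbol f ⟨(γ : SL(2, ℤ)), Gamma1_in_Gamma0 N γ.2⟩ = w := by
        have e : (2 : ℂ) * ((c : ℂ) * cuspSymbol f ⟨(γ : SL(2, ℤ)), Gamma1_in_Gamma0 N γ.2⟩) = 2 * w := by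
          rw [← hw2, hqc]; ring
        exact mul_left_cancel₀ two_ne_zero e
      rw [this]
      exact hw
    | zero => simp
    | add x y _ _ hx hy => rw [mul_add]; exact add_mem hx hy
    | neg x _ hx => rw [mul_neg]; exact neg_mem hx
  -- the two 2-torsion points are cusp images of `τ ↦ c∫f`; (F) makes them non-singular at every prime
  have hpoint : ∀ (x : ℚ) (lam : ℂ), lam ∈ L₀.lattice → lam / 2 ∉ L₀.lattice →
      L₀.weierstrassP (lam / 2) - ((W₀.b₂ : ℚ) : ℂ) / 12 = ((x : ℚ) : ℂ) → HasRationalTwoTorsionX W₀ x →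
      ∃ y : ℚ, 2 * y + W₀.a₁ * x + W₀.a₃ = 0 ∧ ∀ p : ℕ, p.Prime → W₀.HasNonsingularReductionAt p x y := by
    intro x lam hlam hlam2 h℘ hx
    obtain ⟨w, hw, hlq⟩ := hout lam hlam
    obtain ⟨γ, hγ⟩ := exists_cuspSymbol_eq_of_mem_periodLattice f hw
    have hcs : (c : ℂ) * cuspSymbol f ⟨(γ : SL(2, ℤ)), γ.2⟩ = lam / 2 := by
      rw [Subtype.coe_eta, hγ, hlq, hqc]; ring
    have hnot : (c : ℂ) * cuspSymbol f ⟨(γ : SL(2, ℤ)), γ.2⟩ ∉ L₀.lattice := by rwa [hcs]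
    obtain ⟨x', y, hns, hx', -, hred⟩ := hF W₀ f hW₀ L₀ hL₀ c hc0 hcΓ₁ (γ : SL(2, ℤ)) γ.2 hnot
    have hxx : x' = x := by
      have : ((x' : ℚ) : ℂ) = ((x : ℚ) : ℂ) := by rw [hx', hcs, h℘]
      exact_mod_cast this
    subst hxx
    exact ⟨y, two_y_eq_of_equation_of_hasRationalTwoTorsionX W₀ hns.1 hx, hred⟩
  obtain ⟨y₀, hy₀, hred₀⟩ := hpoint x₀ lam₀ hlam₀ hlam₀2 h℘₀ hx₀
  obtain ⟨y₁, hy₁, hred₁⟩ := hpoint x₁ lam₁ hlam₁ hlam₁2 h℘₁ hx₁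
  -- an odd prime `p ∣ N`, bad for `W₀`: `p ∣ Δ_min`
  have hN1 : N ≠ 1 := by omega
  obtain ⟨p, hp, hpN⟩ := Nat.exists_prime_and_dvd hN1
  have hp2 : p ≠ 2 := by rintro rfl; exact h2N hpN
  haveI : Fact p.Prime := ⟨hp⟩
  have hpN' : p ∣ W₀.conductorNorm ℤ := by rw [hN₀]; exact hpN
  have hbad : ¬ W₀.HasGoodReductionAtPrime p := (W₀.dvd_conductorNorm_iff_not_hasGoodReductionAtPrime p).mp hpN'
  have hpΔ : (p : ℤ) ∣ WeierstrassCurve.minimalDiscriminantInt W₀ := by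
    by_contra h
    exact hbad (WeierstrassCurve.hasGoodReductionAtPrime_of_not_dvd W₀ p h)
  -- integral coefficients
  set M : WeierstrassCurve ℤ := WeierstrassCurve.integralModelInt W₀ with hM
  have hmap : M.map (Int.castRingHom ℚ) = W₀ := WeierstrassCurve.map_integralModelInt W₀
  have hb₂ : W₀.b₂ = (M.b₂ : ℚ) := by rw [← hmap, WeierstrassCurve.map_b₂]; simp
  have hb₄ : W₀.b₄ = (M.b₄ : ℚ) := by rw [← hmap, WeierstrassCurve.map_b₄]; simp
  have hb₆ : W₀.b₆ = (M.b₆ : ℚ) := by rw [← hmap, WeierstrassCurve.map_b₆]; simp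
  have hΔ : W₀.Δ = (WeierstrassCurve.minimalDiscriminantInt W₀ : ℚ) := (WeierstrassCurve.cast_minimalDiscriminantInt W₀).symm
  -- the two roots are quarters of integers: `4x` is a root of a monic integer cubic
  have hg₀ := cubic_eq_zero_of_hasRationalTwoTorsionX W₀ hx₀
  have hg₁ := cubic_eq_zero_of_hasRationalTwoTorsionX W₀ hx₁
  have hint : ∀ x : ℚ, 4 * x ^ 3 + W₀.b₂ * x ^ 2 + 2 * W₀.b₄ * x + W₀.b₆ = 0 → ∃ z : ℤ, (z : ℚ) = 4 * x := by
    intro x hx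
    obtain ⟨c8, hc8⟩ : ∃ c8 : ℤ, c8 = 8 * M.b₄ := ⟨_, rfl⟩
    obtain ⟨d16, hd16⟩ : ∃ d16 : ℤ, d16 = 16 * M.b₆ := ⟨_, rfl⟩
    have hmonic : (Cubic.toPoly ⟨1, M.b₂, c8, d16⟩).Monic := Cubic.monic_of_a_eq_one rfl
    have hroot : Polynomial.aeval (4 * x) (Cubic.toPoly ⟨1, M.b₂, c8, d16⟩) = 0 := by
      have hC : ∀ r : ℤ, Polynomial.aeval (4 * x) (Polynomial.C r) = (r : ℚ) := fun r ↦ by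
        rw [Polynomial.aeval_C]; simp
      simp only [Cubic.toPoly, map_add, map_mul, map_pow, hC, Polynomial.aeval_X, Int.cast_one, one_mul]
      rw [hc8, hd16]
      push_cast
      rw [hb₂, hb₄, hb₆] at hx
      linear_combination 16 * hx
    obtain ⟨z, hz⟩ := isInteger_of_is_root_of_monic hmonic hroot
    exact ⟨z, by simpa using hz⟩
  obtain ⟨z₀, hz₀⟩ := hint x₀ hg₀
  obtain ⟨z₁, hz₁⟩ := hint x₁ hg₁
  have hx₀z : x₀ = (z₀ : ℚ) / 4 := by rw [hz₀]; ring
  have hx₁z : x₁ = (z₁ : ℚ) / 4 := by rw [hz₁]; ring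
  -- the third root `e = z₂/4`
  set z₂ : ℤ := -(M.b₂ + z₀ + z₁) with hz₂
  have he : -W₀.b₂ / 4 - x₀ - x₁ = (z₂ : ℚ) / 4 := by rw [hz₂, hb₂, hx₀z, hx₁z]; push_cast; ring
  have he' : -W₀.b₂ / 4 - x₁ - x₀ = (z₂ : ℚ) / 4 := by rw [← he]; ring
  -- `Φ_x` at the two points and `Δ`, in terms of `z₀, z₁, z₂`
  have hΦ₀ : W₀.toAffine.polynomialX.evalEval x₀ y₀ = -((((z₀ - z₁) * (z₀ - z₂) : ℤ) : ℚ) / 16) := by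
    rw [evalEval_polynomialX_of_two_roots W₀ hne hg₀ hg₁ hy₀, he, hx₀z, hx₁z]; push_cast; ring
  have hΦ₁ : W₀.toAffine.polynomialX.evalEval x₁ y₁ = -((((z₁ - z₀) * (z₁ - z₂) : ℤ) : ℚ) / 16) := by
    rw [evalEval_polynomialX_of_two_roots W₀ hne.symm hg₁ hg₀ hy₁, he', hx₀z, hx₁z]; push_cast; ring
  have hΔz : (((WeierstrassCurve.minimalDiscriminantInt W₀ * 256 : ℤ)) : ℚ) =
      ((((z₀ - z₁) * (z₀ - z₂) * (z₁ - z₂)) ^ 2 : ℤ) : ℚ) := by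
    have h := Δ_eq_of_two_roots W₀ hne hg₀ hg₁
    rw [hΔ, he, hx₀z, hx₁z] at h
    push_cast
    linear_combination 256 * h
  have hΔz' : WeierstrassCurve.minimalDiscriminantInt W₀ * 256 = ((z₀ - z₁) * (z₀ - z₂) * (z₁ - z₂)) ^ 2 := by
    exact_mod_cast hΔz
  -- `p` divides the product of the root differences
  have hpZ : Prime (p : ℤ) := Nat.prime_iff_prime_int.mp hp
  have hpD : (p : ℤ) ∣ (z₀ - z₁) * (z₀ - z₂) * (z₁ - z₂) := by
    apply hpZ.dvd_of_dvd_pow (n := 2)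
    rw [← hΔz']
    exact hpΔ.mul_right _
  -- reading (F) at an odd prime: `p ∤ Φ_x`
  have hread : ∀ (x y : ℚ) (zx D : ℤ), x = (zx : ℚ) / 4 → 2 * y + W₀.a₁ * x + W₀.a₃ = 0 →
      W₀.toAffine.polynomialX.evalEval x y = -(((D : ℤ) : ℚ) / 16) → W₀.HasNonsingularReductionAt p x y → ¬ (p : ℤ) ∣ D := by
    intro x y zx D hxz h2 hΦ hns
    rcases hns with hlt | ⟨hne0, hv⟩ | ⟨hne0, _⟩
    · -- `x = zx/4` is `p`-integral
      exfalso
      rw [hxz, show (4 : ℚ) = ((4 : ℕ) : ℚ) by norm_num,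
        padicValRat_intCast_div_natCast zx (by norm_num) (not_dvd_four_sixteen hp hp2).1] at hlt
      omega
    · rw [hΦ] at hne0 hv
      have hD0 : D ≠ 0 := by rintro rfl; simp at hne0
      rw [padicValRat.neg, show (16 : ℚ) = ((16 : ℕ) : ℚ) by norm_num,
        padicValRat_intCast_div_natCast D (by norm_num) (not_dvd_four_sixteen hp hp2).2] at hv
      exact not_dvd_of_padicValInt_eq_zero hD0 (by exact_mod_cast hv)
    · exfalso
      apply hne0
      rw [WeierstrassCurve.Affine.evalEval_polynomialY]
      linear_combination h2
  have h0 := hread x₀ y₀ z₀ ((z₀ - z₁) * (z₀ - z₂)) hx₀z hy₀ hΦ₀ (hred₀ p hp)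
  have h1 := hread x₁ y₁ z₁ ((z₁ - z₀) * (z₁ - z₂)) hx₁z hy₁ hΦ₁ (hred₁ p hp)
  rcases hpZ.dvd_or_dvd hpD with h01 | h12
  · exact h0 h01
  · exact h1 (dvd_mul_of_dvd_right h12 _)

end Summit.BirchSwinnertonDyer.BirchSwinnertonDyer.Theorems.DepletionAtTwo.EvenBranch

end
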